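import Summits.ResolutionOfSingularities.ResolutionOfSingularities.Theorems.DeepCrossCutFanGameFan
import HarnessLib

/-!
# [OURS · decomp-res lens-2 g22 · column 29273 · node «DeepCrossCut»] THE FAN GAME OF LAW (X**) IN KERNEL — §4 (T4)
THE TERMINATION THEOREM: the measure `M(Σ)`, its Dershowitz–Manna decrease at every (P2) move of S3′, well-foundedness

Part of `HOME/decomp-res-lens-2/g22/FanGame.lean` (checked as ONE file: rc 0 · 0 sorry · 0 warnings; the parts are
verbatim slices); see the module
docstring of `DeepCrossCutFanGameLocal` for the KERNEL / PAPER / SCOPE statement of the whole port.  `--supports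
stmt-ResolutionOfSingularities-29273`
(helper).  OURS; AI kernel work; resolution of singularities in characteristic `p` is NOT proved here or anywhere in this chain.
-/


namespace Summit.ResolutionOfSingularities.ResolutionOfSingularities.Theorems.DeepCrossCutFanGame

open Ray

/-! ## §4  The measure `M(Σ)` and its Dershowitz–Manna decrease at every (P2) move of S3′ — (T4) -/

/-- `s_cases`: Auxiliary step of the fan-game kernel (decomp-res lens-2 g22 «DeepCrossCut» companion FanGame.lean
16455400), VERBATIM from the lens's part file (see the module docstring); the statement is its type. [folklore] -/
theorem s_cases (a b : ℕ) : s a b = (a, b) ∨ s a b = (b, a) := by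
  unfold s; simp only [Prod.mk.injEq]; omega

namespace Fan

/-- The weight `W(e) = max(|δ_v|, |δ_w|)` of an edge `e = {v,w}`. -/
def W (F : Fan) (e : Edge) : ℕ := weight (F.ray e.1) (F.ray e.2)

/-- The edge is SPECIAL (a `τ = 1` top line, LEMMA Y.C (ii)). -/
def IsSpecial (F : Fan) (e : Edge) : Prop := Special (F.ray e.1) (F.ray e.2)

/-- Decidability / bookkeeping instance of the fan-game kernel, VERBATIM from the lens's part file (see the module docstring). [folklore] -/
instance (F : Fan) (e : Edge) : Decidable (F.IsSpecial e) := by unfold IsSpecial; infer_instance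

/-- The special edges of `F` (a finite set of normalised index pairs). -/
def specialEdges (F : Fan) : Finset Edge := (F.edges.filter fun e => F.IsSpecial e).toFinset

/-- THE MEASURE `M(Σ)` of the TERMINATION THEOREM (T4): the multiset of the weights of the special edges. -/
def measure (F : Fan) : Multiset ℕ := F.specialEdges.val.map F.W

/-- `mem_specialEdges`: Auxiliary step of the fan-game kernel (decomp-res lens-2 g22 «DeepCrossCut» companion
FanGame.lean 16455400), VERBATIM from the lens's part file (see the module docstring); the statement is its type. [folklore] -/
theorem mem_specialEdges {F : Fan} {e : Edge} : e ∈ F.specialEdges ↔ e ∈ F.edges ∧ F.IsSpecial e := by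
  unfold specialEdges; simp

/-- `isSpecial_s`: Auxiliary step of the fan-game kernel (decomp-res lens-2 g22 «DeepCrossCut» companion
FanGame.lean 16455400), VERBATIM from the lens's part file (see the module docstring); the statement is its type. [folklore] -/
theorem isSpecial_s {F : Fan} {a b : ℕ} : F.IsSpecial (s a b) ↔ Special (F.ray a) (F.ray b) := by
  unfold IsSpecial
  rcases s_cases a b with h | h
  · rw [h]
  · rw [h]; exact special_comm

/-- `W_s`: Auxiliary step of the fan-game kernel (decomp-res lens-2 g22 «DeepCrossCut» companion FanGame.lean
16455400), VERBATIM from the lens's part file (see the module docstring); the statement is its type. [folklore] -/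
theorem W_s (F : Fan) (a b : ℕ) : F.W (s a b) = weight (F.ray a) (F.ray b) := by
  unfold W
  rcases s_cases a b with h | h
  · rw [h]
  · rw [h]; exact weight_comm _ _

/-- `keyLE_s`: Auxiliary step of the fan-game kernel (decomp-res lens-2 g22 «DeepCrossCut» companion FanGame.lean
16455400), VERBATIM from the lens's part file (see the module docstring); the statement is its type. [folklore] -/
theorem keyLE_s {F : Fan} {a b : ℕ} {v w : Ray} :
    KeyLE (F.ray (s a b).1) (F.ray (s a b).2) v w ↔ KeyLE (F.ray a) (F.ray b) v w := by
  rcases s_cases a b with h | h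
  · rw [h]
  · rw [h]; exact keyLE_comm_left

/-- Every edge of a valid fan is a normalised pair `(i, j)`, `i < j < size`. [folklore] -/
theorem edge_lt' {F : Fan} (hV : F.Valid) {e : Edge} (h : e ∈ F.edges) : e.1 < e.2 ∧ e.2 < F.size := by
  obtain ⟨c, hc, he⟩ := mem_edges.mp h
  have hg := hV.2 c hc
  unfold Cone.Good at hg
  rw [Cone.mem_edges] at he
  obtain ⟨e1, e2⟩ := e
  unfold s at he
  simp only [Prod.mk.injEq] at he
  omega

/-- `s_of_mem_edges`: Auxiliary step of the fan-game kernel (decomp-res lens-2 g22 «DeepCrossCut» companion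
FanGame.lean 16455400), VERBATIM from the lens's part file (see the module docstring); the statement is its type. [folklore] -/
theorem s_of_mem_edges {F : Fan} (hV : F.Valid) {e : Edge} (h : e ∈ F.edges) : s e.1 e.2 = e := by
  have h1 := (edge_lt' hV h).1
  obtain ⟨e1, e2⟩ := e
  unfold s; simp only [Prod.mk.injEq]; omega

/-- RULE (P2) OF S3′: `{p,q}` is a special edge of MAXIMAL KEY `(order, |δ_p| + |δ_q|)` among all special edges of `F`. -/
def IsMaxSpecial (F : Fan) (p q : ℕ) : Prop :=
  s p q ∈ F.edges ∧ Special (F.ray p) (F.ray q) ∧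
    ∀ e ∈ F.edges, F.IsSpecial e → KeyLE (F.ray e.1) (F.ray e.2) (F.ray p) (F.ray q)

/-- **(T4) TERMINATION THEOREM — THE DECREASE.**  A (P2) move of S3′ (star subdivision of a maximal special edge
`{p,q}` of a valid fan)
replaces the measure by a strictly smaller multiset in the Dershowitz–Manna order (`Relation.CutExpand (· < ·)`):
the weight `W{p,q}` is
removed and every special edge created (all of them pass through the new ray) has weight `< W{p,q}`. [folklore] -/
theorem cutExpand_measure_subdivide {F : Fan} (hV : F.Valid) {p q : ℕ} (hM : F.IsMaxSpecial p q) :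
    Relation.CutExpand (· < ·) (F.subdivide p q).measure F.measure := by
  classical
  obtain ⟨he0, hsp, hmax⟩ := hM
  obtain ⟨hp, hq, hpq⟩ := edge_lt hV he0
  set F' := F.subdivide p q with hF'
  have hro : ∀ {i}, i < F.size → F'.ray i = F.ray i := fun hi => subdivide_ray_of_lt F p q hi
  have hrn : F'.ray F.size = (F.ray p).add (F.ray q) := subdivide_ray_size F p q
  have hWold : ∀ {e}, e ∈ F.edges → F'.W e = F.W e := by
    intro e he
    obtain ⟨h1, h2⟩ := edge_lt' hV he
    unfold W; rw [hro (lt_trans h1 h2), hro h2]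
  have hSold : ∀ {e}, e ∈ F.edges → (F'.IsSpecial e ↔ F.IsSpecial e) := by
    intro e he
    obtain ⟨h1, h2⟩ := edge_lt' hV he
    unfold IsSpecial; rw [hro (lt_trans h1 h2), hro h2]
  have he0S : s p q ∈ F.specialEdges := mem_specialEdges.mpr ⟨he0, isSpecial_s.mpr hsp⟩
  -- the surviving old special edges `O` and the new special edges `N`
  set N := F'.specialEdges.filter (fun e => e ∉ F.edges) with hN
  set O := F.specialEdges.erase (s p q) with hO
  have hdisj : Disjoint O N := by
    rw [Finset.disjoint_left]
    intro e heO heN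
    rw [hO, Finset.mem_erase, mem_specialEdges] at heO
    rw [hN, Finset.mem_filter] at heN
    exact heN.2 heO.2.1
  have hS' : F'.specialEdges = O ∪ N := by
    ext e
    rw [Finset.mem_union, hO, Finset.mem_erase, hN, Finset.mem_filter, mem_specialEdges, mem_specialEdges]
    constructor
    · rintro ⟨he', hs'⟩
      by_cases he : e ∈ F.edges
      · left
        rcases mem_edges_subdivide hV hpq he' with ⟨-, hne⟩ | ⟨c, -, -, -, hnew⟩
        · exact ⟨hne, he, (hSold he).mp hs'⟩
        · exfalso
          have h2 := (edge_lt' hV he).2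
          rcases hnew with rfl | rfl | rfl <;> (simp only [s] at h2; omega)
      · right; exact ⟨⟨he', hs'⟩, he⟩
    · rintro (⟨hne, he, hs⟩ | ⟨⟨he', hs'⟩, -⟩)
      · exact ⟨mem_edges_subdivide_of_mem hV hpq he hne, (hSold he).mpr hs⟩
      · exact ⟨he', hs'⟩
  -- every new special edge is lighter than `{p,q}`: the local key lemmas of §2
  have hnewlt : ∀ e ∈ N, F'.W e < F.W (s p q) := by
    intro e he
    rw [hN, Finset.mem_filter, mem_specialEdges] at he
    obtain ⟨⟨he', hs'⟩, hnot⟩ := he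
    rcases mem_edges_subdivide hV hpq he' with ⟨he, -⟩ | ⟨c, hc, hcp, hcq, hnew⟩
    · exact absurd he hnot
    · obtain ⟨hrp, hrq, hr3, -, -, hE⟩ := Cone.third_spec (hV.2 c hc) hcp hcq hpq
      have hv := F.ray_of_lt hp hV
      have hw := F.ray_of_lt hq hV
      have hz := F.ray_of_lt hr3 hV
      have hedge : ∀ x, s x (c.third p q) ∈ c.edges → Special (F.ray x) (F.ray (c.third p q)) →
          KeyLE (F.ray x) (F.ray (c.third p q)) (F.ray p) (F.ray q) := by
        intro x hx hsx
        have hxe : s x (c.third p q) ∈ F.edges := mem_edges.mpr ⟨c, hc, hx⟩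
        exact keyLE_s.mp (hmax _ hxe (isSpecial_s.mpr hsx))
      have hmv := hedge p (by rw [hE]; simp)
      have hmw := hedge q (by rw [hE]; simp)
      obtain ⟨h1, h2, h3⟩ := weight_lt_of_new_edge hv hw hz hsp hmv hmw
      rw [W_s F p q]
      have key : ∀ x, x < F.size → e = s x F.size →
          (Special (F.ray x) ((F.ray p).add (F.ray q)) →
            weight (F.ray x) ((F.ray p).add (F.ray q)) < weight (F.ray p) (F.ray q)) →
          F'.W e < weight (F.ray p) (F.ray q) := by
        rintro x hx rfl himp
        rw [W_s, hro hx, hrn]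
        apply himp
        have hsx := isSpecial_s.mp hs'
        rw [hro hx, hrn] at hsx
        exact hsx
      rcases hnew with h | h | h
      · exact key p hp h h1
      · exact key q hq h h2
      · exact key _ hr3 h h3
  -- assemble the cut-expansion `M(F') = (M(F) − {W}) + {weights of N}`
  rw [Relation.cutExpand_iff]
  refine ⟨N.val.map F'.W, F.W (s p q), ?_, ?_, ?_⟩
  · intro a ha
    obtain ⟨e, he, rfl⟩ := Multiset.mem_map.mp ha
    exact hnewlt e (Finset.mem_val.mp he)
  · exact Multiset.mem_map_of_mem F.W (Finset.mem_val.mpr he0S)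
  · show F'.specialEdges.val.map F'.W = (F.specialEdges.val.map F.W).erase (F.W (s p q)) + N.val.map F'.W
    rw [hS', ← Finset.disjUnion_eq_union O N hdisj, Finset.disjUnion_val, Multiset.map_add,
      ← Multiset.map_erase_of_mem F.W _ (Finset.mem_val.mpr he0S), ← Finset.erase_val]
    congr 1
    exact Multiset.map_congr (by rw [hO]) fun e he =>
      hWold (mem_specialEdges.mp (Finset.mem_of_mem_erase (Finset.mem_val.mp he))).1

/-- ONE (P2) MOVE OF S3′: from a valid fan, star-subdivide a maximal special edge. -/
def P2Step (F' F : Fan) : Prop := F.Valid ∧ ∃ p q, F.IsMaxSpecial p q ∧ F' = F.subdivide p q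

/-- `P2Step.valid`: Auxiliary step of the fan-game kernel (decomp-res lens-2 g22 «DeepCrossCut» companion
FanGame.lean 16455400), VERBATIM from the lens's part file (see the module docstring); the statement is its type. [folklore] -/
theorem P2Step.valid {F' F : Fan} (h : P2Step F' F) : F'.Valid := by
  obtain ⟨hV, p, q, hM, rfl⟩ := h
  exact subdivide_valid hV hM.1

/-- **(T4) TERMINATION THEOREM (kernel form).**  The (P2) move relation of S3′ is well founded: it is carried by the
measure into the
Dershowitz–Manna order on `Multiset ℕ`, which is well founded (`WellFounded.cutExpand`). [folklore] -/
theorem wellFounded_P2Step : WellFounded P2Step := by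
  refine Subrelation.wf ?_ (InvImage.wf measure (wellFounded_lt (α := ℕ)).cutExpand)
  intro F' F h
  obtain ⟨hV, p, q, hM, rfl⟩ := h
  exact cutExpand_measure_subdivide hV hM

/-- Corollary: there is no infinite run of (P2) moves of S3′. [folklore] -/
theorem no_infinite_P2_run (f : ℕ → Fan) : ∃ n, ¬ P2Step (f (n + 1)) (f n) :=
  haveI : IsWellFounded Fan P2Step := ⟨wellFounded_P2Step⟩
  WellFounded.not_rel_apply_succ f

end Fan

end Summit.ResolutionOfSingularities.ResolutionOfSingularities.Theorems.DeepCrossCutFanGame
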